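import Summits.Ventures.Crystal3D.Theorems.StickyWulffConstantGenericWallFloorNearIdentityLattice
import HarnessLib

/-!
# Near-identity cap lemma for mixed kissing dozens, part 3c: sharp cap radius via the slot frame identity

HONEST FRAMING. Part of the venture `Summits/Ventures/Crystal3D` (cell `crystal3d-full`), helper
`--supports` the crux `GenericWallFloor` (stmt-Ventures-19480, `route-Ventures-StickyWulffConstant`),
REGISTERED line `WallLedgerG`, stub `stub_twoSlabAdhesion`, rigid-bicrystal rung, module M7 (coincidence
top sites), Σ1 part.  Rung credit only.  Companion of `…NearIdentityLattice`: the twelve slots form a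
TIGHT FRAME (`Σ_k (slotVec k)(slotVec k)ᵀ = 4·1`, integer Gram table `slot_gram`), hence for every matrix
`κ`, `Σ_k |κ · slotVec k|² = 4 ‖κ‖_F²` (`slot_frame_identity`) and for a linear isometry `L`,
`‖M_L − 1‖_F² = ¼ Σ_k ‖L s_k − s_k‖²` (`frob_eq_quarter_slot_sum`).  This turns the hypothesis of
`near_identity_cut` (`‖κ‖_F² ≤ 1/9`, misorientation `≤ 13.5°`) into the slot-sum hypothesis
`Σ_{w ∈ fccSlots} ‖A₂ w − A₁ w‖² ≤ 4/9` of **`coincidence_top_unsaturated_of_slot_sum`** (same conclusion: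
a coincidence top of a non-co-axial rigid bicrystal has `≤ 11` contacts), widening the lattice-form cap
from `≈ 4.8°` (slot-wise `1/12`) to the full `13.5°` of the matrix form.
WHAT THIS IS NOT: the Σ3 cap, the global part of M7; rung F-C1 not moved.
-/

noncomputable section

namespace Summit.Ventures.Crystal3D.Theorems

open Summit.Ventures.Crystal3D Finset Matrix NearIdentity
open Literature.MathematicalPhysics.StatisticalMechanics (barlowPos barlowStacking fccStacking
  constHagg IsHaggSeq haggLabel_const barlowPos_mem)
open scoped InnerProductSpace

/-- Integer Gram table of the slots: `Σ_k slotInt k i · slotInt k j = 8 δᵢⱼ`. -/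
theorem slot_gram : ∀ i j : Fin 3, (∑ k : Fin 12, slotInt k i * slotInt k j) = if i = j then 8 else 0 := by
  decide +kernel

/-- **Tight-frame identity of the twelve slots:** `Σ_k |κ · slotVec k|² = 4 ‖κ‖_F²`. -/
theorem slot_frame_identity (κ : Matrix (Fin 3) (Fin 3) ℝ) :
    ∑ k : Fin 12, (κ *ᵥ slotVec k) ⬝ᵥ (κ *ᵥ slotVec k) = 4 * ∑ i, ∑ j, κ i j ^ 2 := by
  have hs : Real.sqrt 2 ^ 2 = 2 := Real.sq_sqrt (by norm_num)
  have hs0 : Real.sqrt 2 ≠ 0 := by positivity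
  -- real Gram table
  have gram : ∀ j j' : Fin 3, ∑ k : Fin 12, slotVec k j * slotVec k j' = if j = j' then 4 else 0 := by
    intro j j'
    have h := slot_gram j j'
    have h' : (∑ k : Fin 12, slotVec k j * slotVec k j') = (∑ k : Fin 12, (slotInt k j : ℝ) * slotInt k j') / 2 := by
      rw [Finset.sum_div]
      refine Finset.sum_congr rfl fun k _ => ?_
      simp only [slotVec]; field_simp; rw [hs]; ring
    rw [h']
    have hc : (∑ k : Fin 12, (slotInt k j : ℝ) * slotInt k j') = ((∑ k : Fin 12, slotInt k j * slotInt k j' : ℤ) : ℝ) := by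
      push_cast; rfl
    rw [hc, h]
    split_ifs <;> norm_num
  -- expand
  have expand : ∀ k : Fin 12, (κ *ᵥ slotVec k) ⬝ᵥ (κ *ᵥ slotVec k) =
      ∑ i, ∑ j, ∑ j', κ i j * κ i j' * (slotVec k j * slotVec k j') := by
    intro k
    simp only [dotProduct, Matrix.mulVec]
    refine Finset.sum_congr rfl fun i _ => ?_
    rw [Finset.sum_mul_sum]
    refine Finset.sum_congr rfl fun j _ => Finset.sum_congr rfl fun j' _ => by ring
  rw [Finset.sum_congr rfl fun k _ => expand k, Finset.sum_comm]
  rw [Finset.mul_sum]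
  refine Finset.sum_congr rfl fun i _ => ?_
  rw [Finset.sum_comm, Finset.mul_sum]
  refine Finset.sum_congr rfl fun j _ => ?_
  rw [Finset.sum_comm]
  have : ∀ j', ∑ k : Fin 12, κ i j * κ i j' * (slotVec k j * slotVec k j') =
      κ i j * κ i j' * ∑ k : Fin 12, slotVec k j * slotVec k j' := fun j' => by rw [Finset.mul_sum]
  simp only [this, gram]
  simp [Finset.sum_ite_eq, Finset.mem_univ]
  ring

/-- **`‖M_L − 1‖_F² = ¼ Σ_k ‖L s_k − s_k‖²`** for a linear isometry `L` (slots `s_k = slotSite k`). -/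
theorem frob_eq_quarter_slot_sum (L : EuclideanSpace ℝ (Fin 3) ≃ₗᵢ[ℝ] EuclideanSpace ℝ (Fin 3)) :
    ∑ i, ∑ j, ((Matrix.of fun i j => cubicCoords (L (cubicFrame j)) i) - 1) i j ^ 2 =
      (∑ k : Fin 12, ‖L (slotSite k) - slotSite k‖ ^ 2) / 4 := by
  have h := slot_frame_identity ((Matrix.of fun i j => cubicCoords (L (cubicFrame j)) i) - 1)
  have hk : ∀ k : Fin 12, ‖L (slotSite k) - slotSite k‖ ^ 2 =
      (((Matrix.of fun i j => cubicCoords (L (cubicFrame j)) i) - 1) *ᵥ slotVec k) ⬝ᵥ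
        (((Matrix.of fun i j => cubicCoords (L (cubicFrame j)) i) - 1) *ᵥ slotVec k) := by
    intro k
    rw [norm_sq_eq_cubicCoords, cubicCoords_sub, cubicCoords_map, cubicCoords_slotSite, Matrix.sub_mulVec,
      Matrix.one_mulVec]
  rw [Finset.sum_congr rfl fun k _ => hk k, h]
  ring

open scoped Classical in
/-- **Σ1 CAP LEMMA, lattice form, sharp radius.**  As `coincidence_top_unsaturated_near_identity`, but
with the closeness hypothesis in the SHARP averaged form `Σ_{w ∈ fccSlots} ‖A₂ w − A₁ w‖² ≤ 4/9`, which is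
exactly `‖κ‖_F² ≤ 1/9` by the tight-frame identity of the twelve slots (`frob_eq_quarter_slot_sum`): for a
rotation by `ε` this is `32 sin²(ε/2) ≤ 4/9`, i.e. misorientation `ε ≤ 13.5°` (the slot-wise bound `1/12`
of the companion theorem only reaches `≈ 4.8°`). -/
theorem coincidence_top_unsaturated_of_slot_sum
    (A₁ A₂ : EuclideanSpace ℝ (Fin 3) ≃ₗᵢ[ℝ] EuclideanSpace ℝ (Fin 3))
    (t₁ t₂ p u : EuclideanSpace ℝ (Fin 3)) (X : Finset (EuclideanSpace ℝ (Fin 3)))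
    (hnc : ¬ ∃ (L : EuclideanSpace ℝ (Fin 3) ≃ₗᵢ[ℝ] EuclideanSpace ℝ (Fin 3))
        (s₁ s₂ : EuclideanSpace ℝ (Fin 3)) (σ σ' : ℤ → ℤ), IsHaggSeq σ ∧ IsHaggSeq σ' ∧
        (fun x => A₁ x + t₁) '' fccStacking 1 (Real.sqrt (2 / 3)) ⊆
          (fun x => L x + s₁) '' barlowStacking 1 (Real.sqrt (2 / 3)) σ ∧
        (fun x => A₂ x + t₂) '' fccStacking 1 (Real.sqrt (2 / 3)) ⊆
          (fun x => L x + s₂) '' barlowStacking 1 (Real.sqrt (2 / 3)) σ')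
    (hp₁ : p ∈ (fun x => A₁ x + t₁) '' fccStacking 1 (Real.sqrt (2 / 3)))
    (hp₂ : p ∈ (fun x => A₂ x + t₂) '' fccStacking 1 (Real.sqrt (2 / 3)))
    (hsep : ∀ x ∈ X, ∀ y ∈ X, x ≠ y → 1 ≤ dist x y)
    (hX : ∀ q ∈ X, dist p q = 1 → q ∈ (fun x => A₁ x + t₁) '' fccStacking 1 (Real.sqrt (2 / 3)) ∨
      q ∈ (fun x => A₂ x + t₂) '' fccStacking 1 (Real.sqrt (2 / 3)))
    (hu : u ∈ fccSlots) (hup : p + A₁ u ∉ X) (hdown : p + A₁ (-u) ∈ X)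
    (hnear : ∑ w ∈ fccSlots, ‖A₂ w - A₁ w‖ ^ 2 ≤ 4 / 9) :
    (X.filter fun q => dist p q = 1).card ≤ 11 := by
  classical
  set Λ₁ : Set (EuclideanSpace ℝ (Fin 3)) := (fun x => A₁ x + t₁) '' fccStacking 1 (Real.sqrt (2 / 3))
    with hΛ₁
  set Λ₂ : Set (EuclideanSpace ℝ (Fin 3)) := (fun x => A₂ x + t₂) '' fccStacking 1 (Real.sqrt (2 / 3))
    with hΛ₂
  have h12 := card_filter_dist_eq_one_le_twelve X hsep p
  by_contra hcon
  have hdeg : (X.filter fun q => dist p q = 1).card = 12 := by omega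
  obtain ⟨he₁, he₂, he12⟩ := four_le_card_empty_of_saturated_coincidence_top A₁ A₂ t₁ t₂ p u X hnc hp₁ hp₂
    hsep hX hu hup hdown hdeg
  -- the relative isometry `L = A₁⁻¹ A₂` and its cubic matrix `M = 1 + κ`
  set L : EuclideanSpace ℝ (Fin 3) ≃ₗᵢ[ℝ] EuclideanSpace ℝ (Fin 3) := A₂.trans A₁.symm with hL
  have hLw : ∀ w, A₁ (L w) = A₂ w := by intro w; simp [hL]
  have hLn : ∀ w, ‖L w - w‖ = ‖A₂ w - A₁ w‖ := by
    intro w; rw [← A₁.norm_map, map_sub, hLw]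
  set M : Matrix (Fin 3) (Fin 3) ℝ := Matrix.of fun i j => cubicCoords (L (cubicFrame j)) i with hM
  have horth : ∀ i j, (M - 1) i j + (M - 1) j i + ∑ l, (M - 1) l i * (M - 1) l j = 0 := cubicMatrix_horth L
  -- ‖κ‖_F² = ¼ Σ_slots ‖A₂ w − A₁ w‖² ≤ 1/9
  have hfrob := cubicMatrix_frob L
  have hsum : ∑ w ∈ fccSlots, ‖A₂ w - A₁ w‖ ^ 2 = ∑ k : Fin 12, ‖L (slotSite k) - slotSite k‖ ^ 2 := by
    rw [fccSlots_eq_image, Finset.sum_image (fun a _ b _ h => slotSite_injective h)]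
    exact Finset.sum_congr rfl fun k _ => by rw [hLn]
  have hsmall : ∑ i, ∑ j, (M - 1) i j ^ 2 ≤ 1 / 9 := by
    have h4 := frob_eq_quarter_slot_sum L
    rw [← hsum] at h4
    rw [h4]; linarith
  -- ‖κ‖_F² > 0: otherwise `L = 1`, `A₂ = A₁` on all of `ℝ³`, and the pair is co-axial
  have hpos : 0 < ∑ i, ∑ j, (M - 1) i j ^ 2 := by
    rw [hfrob]
    by_contra h0
    push Not at h0
    have hz : ∀ j, L (cubicFrame j) = cubicFrame j := by
      intro j
      have hle : ‖L (cubicFrame j) - cubicFrame j‖ ^ 2 ≤ 0 := by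
        have := Finset.single_le_sum (f := fun j => ‖L (cubicFrame j) - cubicFrame j‖ ^ 2)
          (fun i _ => sq_nonneg _) (Finset.mem_univ j)
        simpa using this.trans h0
      have : ‖L (cubicFrame j) - cubicFrame j‖ = 0 := by
        nlinarith [norm_nonneg (L (cubicFrame j) - cubicFrame j)]
      exact sub_eq_zero.1 (norm_eq_zero.1 this)
    have hM1 : M = 1 := by
      ext i j
      simp only [hM, Matrix.of_apply, hz, cubicCoords_cubicFrame, Matrix.one_apply, Pi.single_apply]
    have hLid : ∀ x, L x = x := by
      intro x
      apply cubicCoords_injective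
      rw [cubicCoords_map, ← hM, hM1, Matrix.one_mulVec]
    apply hnc
    apply coaxial_of_image_eq A₁ A₂ t₁ t₂
    ext y
    constructor
    · rintro ⟨x, hx, rfl⟩
      refine ⟨L.symm x, ?_, ?_⟩
      · have := hLid (L.symm x); rw [L.apply_symm_apply] at this; rw [← this]; exact hx
      · have := hLw (L.symm x); rw [L.apply_symm_apply] at this; exact this.symm
    · rintro ⟨x, hx, rfl⟩
      exact ⟨x, hx, by rw [← hLw, hLid]⟩
  -- the own-set `S ⊆ Fin 12`
  set S : Finset (Fin 12) := Finset.univ.filter fun k => p + A₁ (slotSite k) ∈ X with hS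
  have he₁' : (fccSlots.filter fun w => p + A₁ w ∉ X).card = (Finset.univ \ S).card := by
    rw [fccSlots_eq_image, Finset.filter_image, Finset.card_image_of_injective _ slotSite_injective,
      hS, Finset.sdiff_eq_filter]
    congr 1
    ext k; simp
  have hScard : S.card + (Finset.univ \ S).card = 12 := by
    have := Finset.card_le_univ S
    rw [Finset.card_univ_sdiff]; simp at this ⊢; omega
  -- the foreign neighbours are the balls on foreign slots `p + A₂ (slotSite k)` off `Λ₁`
  set T : Finset (Fin 12) := Finset.univ.filter fun k => p + A₂ (slotSite k) ∈ X ∧ p + A₂ (slotSite k) ∉ Λ₁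
    with hT
  have hsplit := card_neighbours_eq_occupied_add_foreign A₁ t₁ p X hp₁
  rw [hdeg] at hsplit
  have hocc : (fccSlots.filter fun w => p + A₁ w ∈ X).card = S.card := by
    rw [fccSlots_eq_image, Finset.filter_image, Finset.card_image_of_injective _ slotSite_injective]
  have hforT : (X.filter fun q => dist p q = 1 ∧ q ∉ Λ₁).card = T.card := by
    symm
    refine Finset.card_bij (fun k _ => p + A₂ (slotSite k)) ?_ ?_ ?_
    · intro k hk
      obtain ⟨hkX, hkΛ⟩ := (Finset.mem_filter.1 hk).2
      refine Finset.mem_filter.2 ⟨hkX, ?_, hkΛ⟩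
      rw [dist_eq_norm, sub_add_cancel_left, norm_neg, A₂.norm_map, norm_eq_one_of_mem_fccSlots (slotSite_mem k)]
    · intro k₁ _ k₂ _ h
      exact slotSite_injective (A₂.injective (add_left_cancel h))
    · intro q hq
      obtain ⟨hqX, hd, hqΛ⟩ := Finset.mem_filter.1 hq
      have hq₂ : q ∈ Λ₂ := (hX q hqX hd).resolve_left hqΛ
      have hw := symm_sub_mem_fccSlots A₂ t₂ p q hp₂ hq₂ hd
      obtain ⟨k, hk⟩ := exists_slotSite_eq hw
      have hqk : p + A₂ (slotSite k) = q := by rw [hk]; simp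
      exact ⟨k, Finset.mem_filter.2 ⟨Finset.mem_univ _, by rw [hqk]; exact ⟨hqX, hqΛ⟩⟩, hqk⟩
  -- `T` avoids `S` (an own ball and the foreign ball on the twin slot would be `≤ 1/12` apart)
  have hTS : T ⊆ Finset.univ \ S := by
    intro k hk
    obtain ⟨hkX, hkΛ⟩ := (Finset.mem_filter.1 hk).2
    rw [Finset.mem_sdiff]
    refine ⟨Finset.mem_univ _, fun hkS => ?_⟩
    have hown : p + A₁ (slotSite k) ∈ X := (Finset.mem_filter.1 hkS).2
    have hownΛ : p + A₁ (slotSite k) ∈ Λ₁ := movedFcc_add_site_mem A₁ t₁ hp₁ (mem_fcc_of_mem_fccSlots (slotSite_mem k))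
    have hne : p + A₁ (slotSite k) ≠ p + A₂ (slotSite k) := fun e => hkΛ (e ▸ hownΛ)
    have h1 := hsep _ hown _ hkX hne
    rw [dist_eq_norm, add_sub_add_left_eq_sub, ← norm_neg, neg_sub] at h1
    have hle : ‖A₂ (slotSite k) - A₁ (slotSite k)‖ ^ 2 ≤ 4 / 9 := by
      rw [hsum] at hnear
      exact (Finset.single_le_sum (f := fun k => ‖L (slotSite k) - slotSite k‖ ^ 2) (fun i _ => sq_nonneg _)
        (Finset.mem_univ k)).trans hnear |>.trans_eq' (by rw [hLn])
    nlinarith [norm_nonneg (A₂ (slotSite k) - A₁ (slotSite k))]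
  have hTeq : T = Finset.univ \ S := by
    apply Finset.eq_of_subset_of_card_le hTS
    have : S.card + T.card = 12 := by rw [← hocc, ← hforT]; exact hsplit.symm
    omega
  -- `3 ≤ #S ≤ 9`
  have hcS : (fccSlots.filter fun w => p + A₁ w ∉ X).card = 12 - S.card := by rw [he₁']; omega
  have h3 : 3 ≤ S.card := by
    -- `#T ≤ #occupied Λ₂-slots = 12 − e₂ ≤ 8`, and `#T = 12 − #S`
    have hT8 : T.card ≤ 8 := by
      have hsub : T ⊆ Finset.univ.filter fun k => p + A₂ (slotSite k) ∈ X := by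
        intro k hk
        exact Finset.mem_filter.2 ⟨Finset.mem_univ _, (Finset.mem_filter.1 hk).2.1⟩
      have hocc₂ : (Finset.univ.filter fun k => p + A₂ (slotSite k) ∈ X).card =
          (fccSlots.filter fun w => p + A₂ w ∈ X).card := by
        rw [fccSlots_eq_image, Finset.filter_image, Finset.card_image_of_injective _ slotSite_injective]
      have h12' : (fccSlots.filter fun w => p + A₂ w ∈ X).card +
          (fccSlots.filter fun w => p + A₂ w ∉ X).card = 12 := by
        rw [Finset.card_filter_add_card_filter_not, card_fccSlots]
      have := Finset.card_le_card hsub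
      omega
    rw [hTeq] at hT8
    omega
  have h9 : S.card ≤ 9 := by omega
  -- the cap lemma
  obtain ⟨o, hoS, w, hwS, -, hcut⟩ := near_identity_cut (M - 1) horth hpos hsmall S h3 h9
  have hM' : (1 : Matrix (Fin 3) (Fin 3) ℝ) + (M - 1) = M := by abel
  rw [hM'] at hcut
  -- `slotVec o ⬝ (M *ᵥ slotVec w) = ⟪A₁ s_o, A₂ s_w⟫`
  have hinner : slotVec o ⬝ᵥ (M *ᵥ slotVec w) = ⟪A₁ (slotSite o), A₂ (slotSite w)⟫_ℝ := by
    rw [← cubicCoords_slotSite, ← cubicCoords_slotSite, ← cubicCoords_map, ← inner_eq_cubicCoords, ← hLw,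
      A₁.inner_map_map]
  rw [hinner] at hcut
  -- the two balls
  have hown : p + A₁ (slotSite o) ∈ X := (Finset.mem_filter.1 hoS).2
  have hwT : w ∈ T := by rw [hTeq]; exact Finset.mem_sdiff.2 ⟨Finset.mem_univ _, hwS⟩
  obtain ⟨hfor, hforΛ⟩ := (Finset.mem_filter.1 hwT).2
  have hownΛ : p + A₁ (slotSite o) ∈ Λ₁ := movedFcc_add_site_mem A₁ t₁ hp₁ (mem_fcc_of_mem_fccSlots (slotSite_mem o))
  have hne : p + A₁ (slotSite o) ≠ p + A₂ (slotSite w) := fun e => hforΛ (e ▸ hownΛ)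
  have h1 := hsep _ hown _ hfor hne
  rw [dist_eq_norm, add_sub_add_left_eq_sub] at h1
  have hsq : ‖A₁ (slotSite o) - A₂ (slotSite w)‖ ^ 2 =
      ‖A₁ (slotSite o)‖ ^ 2 - 2 * ⟪A₁ (slotSite o), A₂ (slotSite w)⟫_ℝ + ‖A₂ (slotSite w)‖ ^ 2 :=
    norm_sub_sq_real _ _
  rw [A₁.norm_map, A₂.norm_map, norm_eq_one_of_mem_fccSlots (slotSite_mem o),
    norm_eq_one_of_mem_fccSlots (slotSite_mem w)] at hsq
  nlinarith [h1, hsq, hcut, norm_nonneg (A₁ (slotSite o) - A₂ (slotSite w))]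



end Summit.Ventures.Crystal3D.Theorems

end
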